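/- Copyright: the b2b-balaban cell (near-miss cell 7), T⁴-continuum fan-out; row NE7b CRUX team (2), seat
t4-ne7b-formalise-leaf-03 (gen 27) — custodian's build of the OWNER's D-50-1 «THE DECORATED RECORD» (W-ne7bp1-g50-1 (a)(d2),
journal l.33902), part 2 of 2: the embedding, the witness and the terminal theorem.  Released under the licence of the
surrounding project. -/
import Summits.QuantumFields.BalabanUV.T4Continuum.Support.HistoryRealiseCellsRunAssemblyWTVSDataLWD
import Summits.QuantumFields.BalabanUV.T4Continuum.Support.HistoryRealiseCellsRunAssemblyWTVSLW

/-!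
# THE (α) ASSEMBLY UNDER THE PREFIX WITH (ρ) READ OFF THE INDEX, part 2: `HistReadDataLWD.toLW`, THE L-WITNESS AND THE
# TERMINAL THEOREM (D-50-1)
(re-open object (α) of row NE7b; lineage `t4-ne7b-formalise-leaf-03` gen 27, custodian of the S12-W crew)

Summits-side support leaf of the T⁴-continuum cell (rung (B)+1 on a FINITE torus only; NOT infinite volume, NOT the
mass gap, NOT the Clay statement; NOT a proof of the spine estimate NE7b — the cell's OWN estimate, NOT PRINTED, NOT
PROVED).  [folklore] composition BY NAME: one `def` (the record embedding `HistReadDataLWD.toLW`, data-level), its `toLW_data`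
and two theorems; no `[cite:]` tag, nothing printed asserted, no `Prop` fact minted, zero `sorry`.  Append-only: the LW pair
(p289955 ∕ p290621) stays, UNCHANGED BY NAME.

WHAT.  §1 **`HistReadDataLWD.toLW (Dd) : HistReadDataLW …`** — every `HistReadDataLW` field copied from the decorated record
except **`hρ := hρ_of_indexDecor Dd.ℛ Dd.Φf Dd.decor`** (IR-49-1 p293500: (ρ) FROM the reading's fibre decoration through
the OWNER's M5-5 `fibreMass_of_decoration`); `toLW_data`.  §2 **`nonempty_countRoadWitnessT3bWTVSL_of_histReadingLWD`** :=
`…_of_histReadingLW (Dd.toLW) hIr hIv`.  §3 TERMINAL **`continuumYM4Torus_of_histReadingLWD_fsc`**: the LW terminal theorem's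
binders with `HistReadDataLW ↦ HistReadDataLWD` and the two decoration types `(Dc Sl : Type)` bound INSIDE `hRead`'s
existential after the index family (W-ne7bp1-g50-3: the key-side slice type `SIdx I` depends on the bound `I`); proof = `continuumYM4Torus_of_histReadingLW_fsc` ∘ `ForSmallCouplings.mono` ∘ §1.

BY-NAME EFFECT (owner's WALL, row `resum`): (ρ) `FibreMass` LEAVES the R-list of (α) as a volume-type inequality and is
replaced by {(ρ0) R, (ρ1) R index reading [p. 378 (1.71); key side = leaf-02's `HistoryBankingFibreDecorKeys`∕`…Weighted`∕
`…Slice`], (ρ2) T∕PARAMETRIC [pp. 388–390], (ρ3) KERNEL modulo «FIBRE-1»}; (ρ′) (run B's `resumB`, «TRUNC») is untouched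
here.  HONEST SCOPE.  NE7b NOT proved; spine 0∕9.  HONEST DEPENDENCY (cell): continuum YM on T⁴ ⇐ BetaPertH ∧ nine spine
estimates (0/9 proved); BetaPertH ⇐ (D1) ∧ (D4) ∧ CAP+tail; G-an2-4 gates asym, D1 and NE2/3/4.  This file changes none of it.
-/

open Finset MeasureTheory
open Literature.MathematicalPhysics.QuantumFieldTheory.Balaban1983to89
open T4PersistenceDictionary T4PersistentHistoryCount T4BankedInduction T4PrintedShapeBanking
open T4WeightBudget T4GlobalDenominator T4LiveClassFibration T4LiveStructureGas T4LiveGasToTerms T4RecordPriceSeam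
open T4PartnerMultiplicity T4IndicatorShell T4MatchingAssembly T4MatchingClosure T4MatchingClosureSocket T4Continuum
open T4StabilitySocket T4BranchingRecordsGas T4TaggedShapeBanking T4CanonicalMenus T4RenewalChains
open Summit.QuantumFields.BalabanUV.T4Continuum.PlacementBatch Summit.QuantumFields.BalabanUV.T4Continuum.PlacementSkeleton
open Summit.QuantumFields.BalabanUV.T4Continuum.CountThresholdUniform Summit.QuantumFields.BalabanUV.T4Continuum.CountThresholdExit
open Summit.QuantumFields.BalabanUV.T4Continuum.CountSeamJunction Summit.QuantumFields.BalabanUV.T4Continuum.LateMergers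
open Summit.QuantumFields.BalabanUV.T4Continuum.HistoryFlow Summit.QuantumFields.BalabanUV.T4Continuum.HistoryRegeneration
open Summit.QuantumFields.BalabanUV.T4Continuum.HistoryTables Summit.QuantumFields.BalabanUV.T4Continuum.HistoryAssemblyTrees
open Summit.QuantumFields.BalabanUV.T4Continuum.HistoryAssemblyTerms Summit.QuantumFields.BalabanUV.T4Continuum.HistoryAssemblyPedigree
open Summit.QuantumFields.BalabanUV.T4Continuum.HistoryConstants Summit.QuantumFields.BalabanUV.T4Continuum.HistoryGen
open Literature.MathematicalPhysics.QuantumFieldTheory.Balaban1983to89.B13ScaleTransfer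
open Summit.QuantumFields.BalabanUV.T4Continuum.ZoneSkeleton Summit.QuantumFields.BalabanUV.T4Continuum.HistorySocketTH
open Summit.QuantumFields.BalabanUV.T4Continuum.HistoryCaps Summit.QuantumFields.BalabanUV.T4Continuum.HistoryAssemblyPrice
open Summit.QuantumFields.BalabanUV.T4Continuum.HistoryBankingLE Summit.QuantumFields.BalabanUV.T4Continuum.HistoryExitLE
open Summit.QuantumFields.BalabanUV.T4Continuum.HistoryAssemblyTreesLE Summit.QuantumFields.BalabanUV.T4Continuum.HistoryAssemblyTermsLE
open Summit.QuantumFields.BalabanUV.T4Continuum.HistoryRealise Summit.QuantumFields.BalabanUV.T4Continuum.HistoryAssemblyRealiseLE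
open Summit.QuantumFields.BalabanUV.T4Continuum.HistoryAssemblyMult Summit.QuantumFields.BalabanUV.T4Continuum.HistoryAssemblyMultKey
open Summit.QuantumFields.BalabanUV.T4Continuum.HistoryAssemblyRealiseRun Summit.QuantumFields.BalabanUV.T4Continuum.HistoryAssemblyRealiseMult
open Summit.QuantumFields.BalabanUV.T4Continuum.HistoryZones Summit.QuantumFields.BalabanUV.T4Continuum.HistoryRealiseCells
open Summit.QuantumFields.BalabanUV.T4Continuum.HistoryRealiseCellsRun Summit.QuantumFields.BalabanUV.T4Continuum.HistoryAssemblyRealiseRunMult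
open Summit.QuantumFields.BalabanUV.T4Continuum.HistoryRealiseCellsRunMult Summit.QuantumFields.BalabanUV.T4Continuum.HistoryAssemblyMultInstance
open Summit.QuantumFields.BalabanUV.T4Continuum.HistoryJoinsPlacedMember Summit.QuantumFields.BalabanUV.T4Continuum.PlacementSkeleton
open Summit.QuantumFields.BalabanUV.T4Continuum.HistoryJoinsPlacedMult Summit.QuantumFields.BalabanUV.T4Continuum.HistoryRealiseDistinct
open Summit.QuantumFields.BalabanUV.T4Continuum.HistoryRegionTemplates Summit.QuantumFields.BalabanUV.T4Continuum.HistoryCaps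
open Summit.QuantumFields.BalabanUV.T4Continuum.HistoryZoneEvolve (cth)
open Literature.MathematicalPhysics.QuantumFieldTheory.Balaban1983to89.B16SProfile (DropCtl)
open Summit.QuantumFields.BalabanUV.T4Continuum.HistoryRealiseCellsRunMultEnd Summit.QuantumFields.BalabanUV.T4Continuum.HistoryRealiseCellsRunMultEndD
open Summit.QuantumFields.BalabanUV.T4Continuum.HistoryRealiseCellsRunPinnedT3b Summit.QuantumFields.BalabanUV.T4Continuum.HistoryHybridRescale
open Summit.QuantumFields.BalabanUV.T4Continuum.HistoryRealiseCellsRunApex (exists_const_schemeZ)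
open Summit.QuantumFields.BalabanUV.T4Continuum.HistoryRealisePrint Summit.QuantumFields.BalabanUV.T4Continuum.HistoryRealiseWeak
open Summit.QuantumFields.BalabanUV.T4Continuum.HistoryRealisePrintReading Summit.QuantumFields.BalabanUV.T4Continuum.HistoryRealiseWeakReading
open Summit.QuantumFields.BalabanUV.T4Continuum.HistoryRealisePrintCells Summit.QuantumFields.BalabanUV.T4Continuum.HistoryRealiseWeakCells
open Summit.QuantumFields.BalabanUV.T4Continuum.HistoryRealiseCellsRunApexT3b Summit.QuantumFields.BalabanUV.T4Continuum.HistoryRealiseCellsRunApexT3bW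

open Summit.QuantumFields.BalabanUV.T4Continuum.HistoryRealiseCellsRunApexT3bWT Summit.QuantumFields.BalabanUV.T4Continuum.HistoryRealiseCellsRunPinnedT3bWT
open Summit.QuantumFields.BalabanUV.T4Continuum.HistoryRealiseCellsRunHeadlineT3bWT
open Summit.QuantumFields.BalabanUV.T4Continuum.HistoryRealiseCellsRunApexT3bWTV Summit.QuantumFields.BalabanUV.T4Continuum.HistoryBankingVolumePlug
open Summit.QuantumFields.BalabanUV.T4Continuum.HistoryRealiseCellsRunApexT3bWTVS
open Summit.QuantumFields.BalabanUV.T4Continuum.HistoryGenealogyRealise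
open Summit.QuantumFields.BalabanUV.T4Continuum.HistoryGenealogyInstantiate
open Summit.QuantumFields.BalabanUV.T4Continuum.B16HistoryIndexedRepr
open Summit.QuantumFields.BalabanUV.T4Continuum.B16HistoryIndexedTrunc
open Summit.QuantumFields.BalabanUV.T4Continuum.HistoryBankingDiscountCharge
open Summit.QuantumFields.BalabanUV.T4Continuum.HistoryBankingCreditRead
open Summit.QuantumFields.BalabanUV.T4Continuum.HistoryBankingFibreRoom
open Summit.QuantumFields.BalabanUV.T4Continuum.HistoryPriceKeys
open Summit.QuantumFields.BalabanUV.T4Continuum.HistoryRealiseCellsRunSupplyWTVS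
open Summit.QuantumFields.BalabanUV.T4Continuum.HistoryRealiseCellsRunSupplyKeysWTVS

open Summit.QuantumFields.BalabanUV.T4Continuum.HistoryRealiseCellsRunAssemblyWTVSData
open Summit.QuantumFields.BalabanUV.T4Continuum.HistoryRealiseCellsRunAssemblyWTVSDataL
open Summit.QuantumFields.BalabanUV.T4Continuum.HistoryRealiseCellsRunAssemblyWTVSDataLW
open Summit.QuantumFields.BalabanUV.T4Continuum.HistoryRealiseCellsRunAssemblyWTVSDataLWD
open Summit.QuantumFields.BalabanUV.T4Continuum.HistoryRealiseCellsRunAssemblyWTVSL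
open Summit.QuantumFields.BalabanUV.T4Continuum.HistoryRealiseCellsRunAssemblyWTVSLW
open Summit.QuantumFields.BalabanUV.T4Continuum.HistoryRealiseCellsRunApexT3bWTVSL
open Summit.QuantumFields.BalabanUV.T4Continuum.HistoryRealiseCellsRunSupplyFibreWTVS
open Summit.QuantumFields.BalabanUV.T4Continuum.HistoryBankingSharpShares (sBsharp)
open Summit.QuantumFields.BalabanUV.T4Continuum.HistoryBankingRoundingSupply (ellStar)
open Summit.QuantumFields.BalabanUV.T4Continuum.HistoryBankingRoundingUnrounded (sRunr ApFlat)
open Summit.QuantumFields.BalabanUV.T4Continuum.HistoryBankingVolumeWindow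
open Summit.QuantumFields.BalabanUV.T4Continuum.HistoryBankingVolumeSupply

namespace Summit.QuantumFields.BalabanUV.T4Continuum.HistoryRealiseCellsRunAssemblyWTVSLWD

noncomputable section

set_option synthInstance.maxSize 1024

/-! ## §1 The embedding: a decorated record IS a prefix record, (ρ) derived -/

section Embed

variable {F : T4Family} {G : Type*} [GaugeGroup G] [MeasurableSpace G] [HaarData G] [RegularGaugeGroup G]
  {D : FiniteEpsData F G} {C : T4PrintedShapeBanking.Consts} {O : PrintedO1s} {θv : ℝ} {rr d n : ℕ} {hn : 0 < n}
  {g₀ : ℕ → ℝ} {os : List (ULoop F)} {cΛ Lr Φ β₀ : ℝ} {p₁ η η' κ κ₂ κᵥ : ℕ} {Dc Sl : Type} {DomK : ℕ → Type}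
  {I : (K : ℕ) → HIndex (DomK K)} [DecidableEq (HIndex.Idx I)] {DomK' : ℕ → Type} {I' : (K : ℕ) → HIndex (DomK' K)}
  {Xs : ℕ → Type} [∀ K, MeasurableSpace (Xs K)] {μ : (K : ℕ) → Measure (Xs K)} [∀ K, IsFiniteMeasure (μ K)]
  {𝒢 : (K : ℕ) → GoodClass (Xs K)} {Y : ℕ → Type} [∀ K, MeasurableSpace (Y K)] {νB : (K : ℕ) → Measure (Y K)}
  [∀ K, IsFiniteMeasure (νB K)] {𝒢' : (K : ℕ) → GoodClass (Y K)}

omit [RegularGaugeGroup G] in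
/-- **THE DECORATION EMBEDDING** (D-50-1): a `HistReadDataLWD` record IS a `HistReadDataLW` record — every field copied,
`hρ := hρ_of_indexDecor ℛ Φf decor` (IR-49-1: (ρ) `FibreMass` FROM the reading's fibre decoration by the OWNER's M5-5).
[folklore] -/
def _root_.Summit.QuantumFields.BalabanUV.T4Continuum.HistoryRealiseCellsRunAssemblyWTVSDataLWD.HistReadDataLWD.toLW
    (Dd : HistReadDataLWD D C O θv rr d n hn g₀ os cΛ Lr Φ β₀ p₁ η η' κ κ₂ κᵥ Dc Sl I I' Xs μ 𝒢 Y νB 𝒢') :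
    HistReadDataLW D C O θv rr d n hn g₀ os cΛ Lr Φ β₀ p₁ η η' κ κ₂ κᵥ I I' Xs μ 𝒢 Y νB 𝒢' :=
  { l₀ := Dd.l₀, vol := Dd.vol, l₀_pos := Dd.l₀_pos, vol_pos := Dd.vol_pos, K₀ := Dd.K₀, RA := Dd.RA, ρA := Dd.ρA,
    holdsA := Dd.holdsA, intA := Dd.intA, H2A := Dd.H2A, ℛ := Dd.ℛ, hL := Dd.hL, hs := Dd.hs, Φf := Dd.Φf,
    hR := Dd.hR, isRj := Dd.isRj, one_le_R := Dd.one_le_R, hL4 := Dd.hL4, hprof := Dd.hprof, hdrop := Dd.hdrop,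
    hN := Dd.hN, hRm := Dd.hRm, hRmS := Dd.hRmS, hRm2 := Dd.hRm2, hD := Dd.hD, hreg := Dd.hreg, hn₁ := Dd.hn₁,
    hE₂ := Dd.hE₂, hE₃pos := Dd.hE₃pos, sB := Dd.sB, φB := Dd.φB, φR := Dd.φR, β' := Dd.β', hF := Dd.hF,
    h29 := Dd.h29, W := Dd.W, one_le_W := Dd.one_le_W, Wi := Dd.Wi, BAi := Dd.BAi, mi := Dd.mi, hWi := Dd.hWi,
    hBA := Dd.hBA, hmi := Dd.hmi, hρ := hρ_of_indexDecor Dd.ℛ Dd.Φf Dd.decor, c₀ := Dd.c₀, n₁ := Dd.n₁,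
    c₀_pos := Dd.c₀_pos, floor := Dd.floor, floor' := Dd.floor', sites := Dd.sites, sites' := Dd.sites', RB := Dd.RB,
    ρB := Dd.ρB, holdsB := Dd.holdsB, intB := Dd.intB, H2B := Dd.H2B, trunc := Dd.trunc, htr := Dd.htr, dB := Dd.dB,
    mup := Dd.mup, sB' := Dd.sB', φB' := Dd.φB', φR' := Dd.φR', upB := Dd.upB, deadB_nonneg := Dd.deadB_nonneg,
    resumB := Dd.resumB, mup_bd := Dd.mup_bd, shA := Dd.shA, shB := Dd.shB, Wsh := Dd.Wsh, shell := Dd.shell,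
    Cc := Dd.Cc, Rr := Dd.Rr, CcRec := Dd.CcRec, RrRec := Dd.RrRec, ν := Dd.ν, u := Dd.u, s₂ := Dd.s₂, q₀ := Dd.q₀,
    r := Dd.r, s := Dd.s, budget := Dd.budget, sum_r := Dd.sum_r, sum_u := Dd.sum_u, sum_s := Dd.sum_s,
    sum_s₂ := Dd.sum_s₂, hcΛ := Dd.hcΛ, hΛ := Dd.hΛ, hθv := Dd.hθv, hβ₀ := Dd.hβ₀, hLr := Dd.hLr, hΦ := Dd.hΦ,
    m := Dd.m, hm := Dd.hm, hexpR := Dd.hexpR, hexpR' := Dd.hexpR', hexpB := Dd.hexpB, hexpF := Dd.hexpF,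
    hexpV := Dd.hexpV, hη := Dd.hη, hη' := Dd.hη', hκ := Dd.hκ, hκ₂ := Dd.hκ₂, hκᵥ := Dd.hκᵥ, hp₀ := Dd.hp₀,
    hAp := Dd.hAp, hγ₀ := Dd.hγ₀, hA₁ := Dd.hA₁, hA₀ := Dd.hA₀, hM := Dd.hM, hβd := Dd.hβd, hφB := Dd.hφB,
    hφR := Dd.hφR, hφB' := Dd.hφB', hφR' := Dd.hφR', hsB := Dd.hsB, hsB' := Dd.hsB', p27 := Dd.p27, hp27 := Dd.hp27,
    h27 := Dd.h27 }

omit [RegularGaugeGroup G] in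
/-- the embedding keeps the reading, the threshold, the factor data, the source radius, the truncation and the letter
families (so the LW assembly's suppliers are unchanged) [folklore] -/
theorem _root_.Summit.QuantumFields.BalabanUV.T4Continuum.HistoryRealiseCellsRunAssemblyWTVSDataLWD.HistReadDataLWD.toLW_data
    (Dd : HistReadDataLWD D C O θv rr d n hn g₀ os cΛ Lr Φ β₀ p₁ η η' κ κ₂ κᵥ Dc Sl I I' Xs μ 𝒢 Y νB 𝒢') :
    Dd.toLW.ℛ = Dd.ℛ ∧ Dd.toLW.K₀ = Dd.K₀ ∧ Dd.toLW.Φf = Dd.Φf ∧ Dd.toLW.l₀ = Dd.l₀ ∧ Dd.toLW.trunc = Dd.trunc ∧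
      Dd.toLW.W = Dd.W ∧ Dd.toLW.φB = Dd.φB ∧ Dd.toLW.φR = Dd.φR ∧ Dd.toLW.sB = Dd.sB :=
  ⟨rfl, rfl, rfl, rfl, rfl, rfl, rfl, rfl, rfl⟩

end Embed

/-! ## §2 The L-witness from a decorated record and the two windows -/

section Assembly

variable {F : T4Family} {G : Type*} [GaugeGroup G] [MeasurableSpace G] [HaarData G] [RegularGaugeGroup G]
  {D : FiniteEpsData F G} {C : T4PrintedShapeBanking.Consts} {O : PrintedO1s} {θv : ℝ} {rr d n : ℕ} {hn : 0 < n}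
  {g₀ : ℕ → ℝ} {os : List (ULoop F)} {cΛ Lr Φ β₀ : ℝ} {p₁ η η' κ κ₂ κᵥ : ℕ} {Dc Sl : Type} {DomK : ℕ → Type}
  {I : (K : ℕ) → HIndex (DomK K)} [DecidableEq (HIndex.Idx I)] {DomK' : ℕ → Type} {I' : (K : ℕ) → HIndex (DomK' K)}
  {Xs : ℕ → Type} [∀ K, MeasurableSpace (Xs K)] {μ : (K : ℕ) → Measure (Xs K)} [∀ K, IsFiniteMeasure (μ K)]
  {𝒢 : (K : ℕ) → GoodClass (Xs K)} {Y : ℕ → Type} [∀ K, MeasurableSpace (Y K)] {νB : (K : ℕ) → Measure (Y K)}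
  [∀ K, IsFiniteMeasure (νB K)] {𝒢' : (K : ℕ) → GoodClass (Y K)}

omit [RegularGaugeGroup G] in
/-- **THE (α) ASSEMBLY UNDER THE PREFIX, (ρ) READ OFF THE INDEX — THE L-WITNESS** (D-50-1): from `HistReadDataLWD` and the
two coupling windows, `Nonempty (CountRoadWitnessT3bWTVSL …)` — the LW assembly ∘ `toLW`. [folklore] -/
theorem nonempty_countRoadWitnessT3bWTVSL_of_histReadingLWD
    (Dd : HistReadDataLWD D C O θv rr d n hn g₀ os cΛ Lr Φ β₀ p₁ η η' κ κ₂ κᵥ Dc Sl I I' Xs μ 𝒢 Y νB 𝒢')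
    (hIr : ∀ K, (D.C ⟨K, F.m, g₀ K⟩).flow.InInterval
      (Real.exp (-(ellStar C O F.L (O.d + 3) η η' κ (ApFlat O.γ₀ O.A₁ O.M Lr O.d) Φ / 2))) K)
    (hIv : ∀ K, (D.C ⟨K, F.m, g₀ K⟩).flow.InInterval
      (Real.exp (-(ellVol C d κ₂ κᵥ cΛ θv (1 + β₀) (jvol d (1 + β₀)) / 2))) K) :
    Nonempty (CountRoadWitnessT3bWTVSL D C O θv rr d n hn g₀ os (HIndex.Idx I) (ℕ × Lab d) (Lab d)) :=
  nonempty_countRoadWitnessT3bWTVSL_of_histReadingLW Dd.toLW hIr hIv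

end Assembly

/-! ## §3 The terminal theorem: the headline with `hData` supplied by SOME decorated record, for all small couplings -/

section SU

variable {F : T4Family} {N : ℕ} [NeZero N] {ℰ : LoopAverage (Matrix.specialUnitaryGroup (Fin N) ℂ)}

/-- **THE HEADLINE PREDICATE FROM A DECORATED READING OF (1.72) UNDER THE HEADLINE's OWN PREFIX** (D-50-1):
`T4ContinuumYM4Torus.ContinuumYM4Torus D` for (0.4)-block-averaged data on `SU(N)` with a measurable small-loop average,
GIVEN `(B)` and `BetaPertHyp` BY NAME, the sign conventions, END v3.1's constants-only side conditions, the ten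
window-threshold letters (bound here), and — for all small-coupling tuned runs and every loop string — SOME decoration
types `Dc Sl` and SOME decorated record `HistReadDataLWD … Dc Sl …` (its R-list: NO `RoundingRoomF`, NO volume calibration, NO (ρ) `FibreMass`
— instead the decoration's (ρ0)–(ρ3) displays).  Proof: `continuumYM4Torus_of_histReadingLW_fsc` ∘ `ForSmallCouplings.mono`
∘ `toLW`.  CONDITIONAL on everything the record displays; NE7b NOT proved; count 0∕9. [folklore] -/
theorem continuumYM4Torus_of_histReadingLWD_fsc (D : FiniteEpsData F (Matrix.specialUnitaryGroup (Fin N) ℂ))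
    (hBA : D.IsBlockAveraged ℰ) (hE : ℰ.MeasurableE)
    (hB : B16.EndStatementBPrinted D.C) (hβ : BetaPertHyp D.βfun) (hsign : B16.SignConventions D.C)
    {C : T4PrintedShapeBanking.Consts} {O : PrintedO1s}
    {rr : ℕ} {β₀ : ℝ} (h : ThresholdOK C F.L rr β₀) (hμ : 0 < C.μ) (d n : ℕ)
    (hκ₁ : (d : ℝ) * Real.log F.L + 2 * Real.log 2 ≤ C.κ₁) (hE₀ : Real.log (2 + birthMass C) ≤ C.E₀)
    (hA₀ : 1 ≤ C.A₀) (hβ₀ : 0 < β₀) (hLβ : (F.L : ℝ) * β₀ ≤ 1) (hn₁ : 13 ≤ C.n₁) (hn : 0 < n)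
    {θ θv : ℝ} (hθ : 0 < θ) (hslack : C.a + (θ + θv) ≤ O.γ₀ * O.A₁ ^ 2 / 2)
    (hE₂ : 0 < C.E₂) (hE₃ : 0 ≤ C.E₃) {sS : ℕ} (hsS : 1 ≤ sS)
    (hsmall : (((2 * cth 32 1 sS + 1) ^ d : ℕ) : ℝ) * (5 : ℝ) ^ d * ((max 1 (2 * 32 + 2) : ℕ) : ℝ) ≤
      (F.L : ℝ) ^ (sS / 2) / 2)
    {θc : ℝ} (hθc0 : 0 ≤ θc) (hθc1 : θc < 1) (hθcs : 1 / 2 ≤ θc ^ sS)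
    {cΛ Lr Φ b₀ : ℝ} {p₁ η η' κ κ₂ κᵥ : ℕ}
    (hRead : T4ContinuumYM4Torus.ForSmallCouplings D fun g₀ => ∀ os : List (ULoop F),
        ∃ (DomK : ℕ → Type) (I : (K : ℕ) → HIndex (DomK K)) (_ : DecidableEq (HIndex.Idx I)) (DomK' : ℕ → Type)
          (I' : (K : ℕ) → HIndex (DomK' K)) (X : ℕ → Type) (_ : ∀ K, MeasurableSpace (X K))
          (μ : (K : ℕ) → Measure (X K)) (_ : ∀ K, IsFiniteMeasure (μ K)) (𝒢 : (K : ℕ) → GoodClass (X K))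
          (Y : ℕ → Type) (_ : ∀ K, MeasurableSpace (Y K)) (νB : (K : ℕ) → Measure (Y K))
          (_ : ∀ K, IsFiniteMeasure (νB K)) (𝒢' : (K : ℕ) → GoodClass (Y K)) (Dc Sl : Type),
          Nonempty (HistReadDataLWD D C O θv rr d n hn g₀ os cΛ Lr Φ b₀ p₁ η η' κ κ₂ κᵥ Dc Sl I I' X μ 𝒢 Y νB 𝒢')) :
    T4ContinuumYM4Torus.ContinuumYM4Torus D :=
  continuumYM4Torus_of_histReadingLW_fsc D hBA hE hB hβ hsign h hμ d n hκ₁ hE₀ hA₀ hβ₀ hLβ hn₁ hn hθ hslack hE₂ hE₃ hsS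
    hsmall hθc0 hθc1 hθcs
    (hRead.mono fun g₀ hg os => by
      obtain ⟨DomK, I, iI, DomK', I', X, mX, μ, hμf, 𝒢, Y, mY, νB, hνf, 𝒢', Dc, Sl, ⟨Dd⟩⟩ := hg os
      exact ⟨DomK, I, iI, DomK', I', X, mX, μ, hμf, 𝒢, Y, mY, νB, hνf, 𝒢', ⟨Dd.toLW⟩⟩)

end SU

end

end Summit.QuantumFields.BalabanUV.T4Continuum.HistoryRealiseCellsRunAssemblyWTVSLWD
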